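import Mathlib
import HarnessLib
import Literature.NumberTheory.LFunctions.ZetaScrewSeriesProofs
import Literature.NumberTheory.LFunctions.FordZetaZeroRecipSqSum
import Literature.NumberTheory.LFunctions.ZetaZerosProofs
import Summits.RiemannHypothesis.RiemannHypothesis.Theorems.IntegerScrewZetaScrewDatumWindow

/-!
# Route `IntegerScrew`, LINE «SCREW DEPTH–HEIGHT DICTIONARY» (rh-idea-10/A) — ζ's SHIFTED ZERO DATUM
# IS ADMISSIBLE (item `stmt-RiemannHypothesis-21806`, `ZetaScrewDatumAdmissible`)

The number-field side of the dictionary.  Let `Z(w) = m(½ + w)` if `½ + w` is a non-trivial zero of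
`ζ` (multiplicity `m = riemannZetaZeroOrder`, read in `ℕ`) and `Z(w) = 0` otherwise — the item states
it as `Z = indicator of (½ + ·)⁻¹(non-trivial zeros) applied to (m(½ + ·)).toNat`.  Then

* (i)  `Σ_w Z(w)/|w|² = σ ≤ 1/20` as a `HasSum` over `ℂ` (`σ = Σ_ρ m_ρ/|ρ − ½|² ≤ (197/196)·0.0462`,
  from the tree's PROVED Ford-type bound `Σ_ρ m_ρ/|ρ|² < 0.0462`
  (`tsum_zeroOrder_div_norm_sq_lt`) and `|ρ|² ≤ (197/196)|ρ − ½|²` (`β ∈ (0,1)`, `γ² > 196`));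
* (ii) `Z(w) ≠ 0 ⇒ |Re w| < ½ ∧ |Im w| ≥ 1` (open critical strip; `|γ| > 14`,
  `FordL33.fourteen_lt_abs_im`);
* (iii) for `|T| ≥ 1`, `Σ_w 1_{|Im w − T| ≤ 1} Z(w) ≤ log|T| + 20` (finite support; conjugation
  symmetry `m(ρ̄) = m(ρ)` reduces `T ≤ −1` to `T ≥ 1`, which is `window_count_le` of
  `IntegerScrewZetaScrewDatumWindow`);
* (iv) `Ψ(L) = Σ_w Z(w)·Re((cosh(wL) − 1)/w²)` for every real `L` (real part of Suzuki's series
  `Suzuki2023_thm11_series_holds`, PROVED, reindexed by `ρ ↦ ρ − ½`).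

All sums over `w : ℂ` are transported from sums over the subtype of non-trivial zeros along the
injection `ρ ↦ ρ − ½` (`hasSum_shift_iff`).  Everything used is PROVED in the tree; RH is NOT proved
by this file and nothing here bears on the truth of RH.  References: M. Suzuki, *J. Lond. Math. Soc.*
(2) 108 (2023) Thm 1.1 [Suzuki2023]; K. Ford, *Zero-free regions for the Riemann zeta function*
(2002) Lemma 3.3 (via `FordZetaZeroRecipSqSum`).
-/

noncomputable section

-- D-0017: `Summit.<S>.<S>.…` is the designed namespace of a single-problem summit.
set_option linter.dupNamespace false

namespace Summit.RiemannHypothesis.RiemannHypothesis.Theorems.IntegerScrew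

open Finset Literature.NumberTheory.LFunctions
open scoped ComplexConjugate

/-! ### Transport of sums along `ρ ↦ ρ − ½` -/

/-- A sum over `ℂ` of a function vanishing off `{w : ½ + w ∈ S}` is a sum over `S` reindexed by
`ρ ↦ ρ − ½`. [folklore] -/
theorem hasSum_shift_iff {S : Set ℂ} (f : ℂ → ℝ) (hf : ∀ w : ℂ, (1 / 2 + w) ∉ S → f w = 0) (a : ℝ) :
    HasSum f a ↔ HasSum (fun ρ : S => f ((ρ : ℂ) - 1 / 2)) a := by
  have hg : Function.Injective (fun ρ : S => (ρ : ℂ) - 1 / 2) := by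
    intro x y h
    apply Subtype.ext
    have h' : (x : ℂ) - 1 / 2 = (y : ℂ) - 1 / 2 := h
    exact sub_left_injective h'
  have hr : ∀ x, x ∉ Set.range (fun ρ : S => (ρ : ℂ) - 1 / 2) → f x = 0 := by
    intro x hx
    apply hf
    intro hmem
    exact hx ⟨⟨1 / 2 + x, hmem⟩, by simp⟩
  exact (hg.hasSum_iff hr).symm

/-- `‖ρ‖² ≤ (197/196)·‖ρ − ½‖²` for a non-trivial zero `ρ` (`0 < Re ρ < 1`, `|Im ρ| > 14`). [folklore] -/
theorem norm_sq_le_norm_sub_half_sq {ρ : ℂ} (hρ : ρ ∈ ZetaZeros.riemannZetaNontrivialZeros) :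
    ‖ρ‖ ^ 2 ≤ (197 / 196) * ‖ρ - 1 / 2‖ ^ 2 := by
  have hre0 := ZetaZeros.riemannZetaNontrivialZeros.re_pos hρ
  have hre1 := ZetaZeros.riemannZetaNontrivialZeros.re_lt_one hρ
  have him : 14 < |ρ.im| := FordL33.fourteen_lt_abs_im ⟨ρ, hρ⟩
  have him2 : 196 < ρ.im ^ 2 := by
    nlinarith [abs_nonneg ρ.im, abs_mul_abs_self ρ.im]
  have e1 : ‖ρ‖ ^ 2 = ρ.re ^ 2 + ρ.im ^ 2 := by
    rw [Complex.sq_norm, Complex.normSq_apply]; ring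
  have e2 : ‖ρ - 1 / 2‖ ^ 2 = (ρ.re - 1 / 2) ^ 2 + ρ.im ^ 2 := by
    rw [Complex.sq_norm, Complex.normSq_apply]
    simp
    ring
  rw [e1, e2]
  nlinarith

/-- `Σ_ρ m_ρ/|ρ − ½|²` converges and is `≤ 1/20` (comparison with `Σ_ρ m_ρ/|ρ|² < 0.0462`). [folklore] -/
theorem summable_order_div_norm_sub_half_sq :
    Summable (fun ρ : ZetaZeros.riemannZetaNontrivialZeros =>
        (riemannZetaZeroOrder (ρ : ℂ) : ℝ) / ‖(ρ : ℂ) - 1 / 2‖ ^ 2) ∧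
      ∑' ρ : ZetaZeros.riemannZetaNontrivialZeros,
          (riemannZetaZeroOrder (ρ : ℂ) : ℝ) / ‖(ρ : ℂ) - 1 / 2‖ ^ 2 ≤ 1 / 20 := by
  have hsum0 : Summable (fun ρ : ZetaZeros.riemannZetaNontrivialZeros =>
      (riemannZetaZeroOrder (ρ : ℂ) : ℝ) / ‖(ρ : ℂ)‖ ^ 2) := FordL33.summable_order_div_norm_sq
  have hlt : ∑' ρ : ZetaZeros.riemannZetaNontrivialZeros,
      (riemannZetaZeroOrder (ρ : ℂ) : ℝ) / ‖(ρ : ℂ)‖ ^ 2 < 0.0462 := tsum_zeroOrder_div_norm_sq_lt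
  have hnn : ∀ ρ : ZetaZeros.riemannZetaNontrivialZeros,
      0 ≤ (riemannZetaZeroOrder (ρ : ℂ) : ℝ) / ‖(ρ : ℂ) - 1 / 2‖ ^ 2 :=
    fun ρ => div_nonneg (FordL33.order_pos ρ).le (sq_nonneg _)
  have hcmp : ∀ ρ : ZetaZeros.riemannZetaNontrivialZeros,
      (riemannZetaZeroOrder (ρ : ℂ) : ℝ) / ‖(ρ : ℂ) - 1 / 2‖ ^ 2 ≤
        (197 / 196) * ((riemannZetaZeroOrder (ρ : ℂ) : ℝ) / ‖(ρ : ℂ)‖ ^ 2) := by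
    intro ρ
    have hm := (FordL33.order_pos ρ).le
    have hY : 0 < ‖(ρ : ℂ)‖ ^ 2 := by
      have := FordL33.fourteen_lt_norm ρ; positivity
    have hA := norm_sq_le_norm_sub_half_sq ρ.2
    have hX : 0 < ‖(ρ : ℂ) - 1 / 2‖ ^ 2 := by nlinarith
    calc (riemannZetaZeroOrder (ρ : ℂ) : ℝ) / ‖(ρ : ℂ) - 1 / 2‖ ^ 2
        = (197 / 196) * (riemannZetaZeroOrder (ρ : ℂ) : ℝ) / ((197 / 196) * ‖(ρ : ℂ) - 1 / 2‖ ^ 2) := by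
          rw [mul_div_mul_left _ _ (by norm_num : (197 / 196 : ℝ) ≠ 0)]
      _ ≤ (197 / 196) * (riemannZetaZeroOrder (ρ : ℂ) : ℝ) / ‖(ρ : ℂ)‖ ^ 2 :=
          div_le_div_of_nonneg_left (by positivity) hY hA
      _ = (197 / 196) * ((riemannZetaZeroOrder (ρ : ℂ) : ℝ) / ‖(ρ : ℂ)‖ ^ 2) := by ring
  have hsum1 : Summable (fun ρ : ZetaZeros.riemannZetaNontrivialZeros =>
      (riemannZetaZeroOrder (ρ : ℂ) : ℝ) / ‖(ρ : ℂ) - 1 / 2‖ ^ 2) :=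
    (hsum0.mul_left (197 / 196)).of_nonneg_of_le hnn hcmp
  refine ⟨hsum1, ?_⟩
  have hle := hsum1.tsum_le_tsum hcmp (hsum0.mul_left (197 / 196))
  rw [tsum_mul_left] at hle
  norm_num at hlt ⊢
  linarith

variable {Z : ℂ → ℕ}

/-- Off the shifted zero set the datum vanishes. [folklore] -/
theorem datum_eq_zero (hZ : ∀ w : ℂ, Z w = Set.indicator ((fun v : ℂ => 1 / 2 + v) ⁻¹'
      ZetaZeros.riemannZetaNontrivialZeros) (fun v : ℂ => (riemannZetaZeroOrder (1 / 2 + v)).toNat) w)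
    {w : ℂ} (hw : (1 / 2 + w) ∉ ZetaZeros.riemannZetaNontrivialZeros) : Z w = 0 := by
  rw [hZ]
  apply Set.indicator_of_notMem
  exact hw

/-- On the shifted zero set the datum is the multiplicity: `Z(ρ − ½) = m(ρ)`. [folklore] -/
theorem datum_shift_eq (hZ : ∀ w : ℂ, Z w = Set.indicator ((fun v : ℂ => 1 / 2 + v) ⁻¹'
      ZetaZeros.riemannZetaNontrivialZeros) (fun v : ℂ => (riemannZetaZeroOrder (1 / 2 + v)).toNat) w)
    {ρ : ℂ} (hρ : ρ ∈ ZetaZeros.riemannZetaNontrivialZeros) :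
    (Z (ρ - 1 / 2) : ℝ) = (riemannZetaZeroOrder ρ : ℝ) := by
  have hρ' : (1 / 2 : ℂ) + (ρ - 1 / 2) = ρ := by ring
  have hmem : (ρ - 1 / 2) ∈ (fun v : ℂ => 1 / 2 + v) ⁻¹' ZetaZeros.riemannZetaNontrivialZeros := by
    show (1 / 2 : ℂ) + (ρ - 1 / 2) ∈ ZetaZeros.riemannZetaNontrivialZeros
    rw [hρ']; exact hρ
  rw [hZ, Set.indicator_of_mem hmem]
  simp only [hρ']
  have h1 := ZetaZeros.riemannZetaNontrivialZeros.one_le_order hρ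
  have h2 : ((riemannZetaZeroOrder ρ).toNat : ℤ) = riemannZetaZeroOrder ρ := Int.toNat_of_nonneg (by omega)
  exact_mod_cast h2

/-- `Z(w) ≠ 0` forces `½ + w` to be a non-trivial zero. [folklore] -/
theorem mem_of_datum_ne_zero (hZ : ∀ w : ℂ, Z w = Set.indicator ((fun v : ℂ => 1 / 2 + v) ⁻¹'
      ZetaZeros.riemannZetaNontrivialZeros) (fun v : ℂ => (riemannZetaZeroOrder (1 / 2 + v)).toNat) w)
    {w : ℂ} (hw : Z w ≠ 0) : (1 / 2 + w) ∈ ZetaZeros.riemannZetaNontrivialZeros := by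
  by_contra h
  exact hw (datum_eq_zero hZ h)

/-- The datum is conjugation invariant: `Z(w̄) = Z(w)` (`m(ρ̄) = m(ρ)`). [folklore] -/
theorem datum_conj (hZ : ∀ w : ℂ, Z w = Set.indicator ((fun v : ℂ => 1 / 2 + v) ⁻¹'
      ZetaZeros.riemannZetaNontrivialZeros) (fun v : ℂ => (riemannZetaZeroOrder (1 / 2 + v)).toNat) w)
    (w : ℂ) : Z (conj w) = Z w := by
  have hc : (1 / 2 : ℂ) + conj w = conj (1 / 2 + w) := by
    apply Complex.ext <;> simp
  by_cases h : (1 / 2 + w) ∈ ZetaZeros.riemannZetaNontrivialZeros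
  · have h' : (1 / 2 : ℂ) + conj w ∈ ZetaZeros.riemannZetaNontrivialZeros := by
      rw [hc]; exact ZetaZeros.riemannZetaNontrivialZeros.conj_mem h
    rw [hZ, hZ, Set.indicator_of_mem (show conj w ∈ _ from h'), Set.indicator_of_mem (show w ∈ _ from h)]
    simp only [hc]
    rw [riemannZetaZeroOrder_conj_holds]
  · have h' : (1 / 2 : ℂ) + conj w ∉ ZetaZeros.riemannZetaNontrivialZeros := by
      intro h'
      apply h
      have hc' : conj ((1 / 2 : ℂ) + conj w) = 1 / 2 + w := by
        apply Complex.ext <;> simp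
      have := ZetaZeros.riemannZetaNontrivialZeros.conj_mem h'
      rw [hc'] at this
      exact this
    rw [datum_eq_zero hZ h, datum_eq_zero hZ h']

/-! ### (i) `Σ Z(w)/|w|² ≤ 1/20` -/

/-- Part (i): `Σ_w Z(w)/|w|² = σ ≤ 1/20`. [folklore] -/
theorem datum_hasSum_div_norm_sq (hZ : ∀ w : ℂ, Z w = Set.indicator ((fun v : ℂ => 1 / 2 + v) ⁻¹'
      ZetaZeros.riemannZetaNontrivialZeros) (fun v : ℂ => (riemannZetaZeroOrder (1 / 2 + v)).toNat) w) :
    ∃ σ : ℝ, σ ≤ 1 / 20 ∧ HasSum (fun w : ℂ => (Z w : ℝ) / ‖w‖ ^ 2) σ := by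
  obtain ⟨hsum, hle⟩ := summable_order_div_norm_sub_half_sq
  refine ⟨_, hle, ?_⟩
  rw [hasSum_shift_iff (S := ZetaZeros.riemannZetaNontrivialZeros) _ (fun w hw => by
    rw [datum_eq_zero hZ hw]; simp)]
  convert hsum.hasSum using 1
  funext ρ
  rw [datum_shift_eq hZ ρ.2]

/-! ### (ii) strip and height -/

/-- Part (ii): `Z(w) ≠ 0 ⇒ |Re w| < ½ ∧ 1 ≤ |Im w|`. [folklore] -/
theorem datum_support (hZ : ∀ w : ℂ, Z w = Set.indicator ((fun v : ℂ => 1 / 2 + v) ⁻¹'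
      ZetaZeros.riemannZetaNontrivialZeros) (fun v : ℂ => (riemannZetaZeroOrder (1 / 2 + v)).toNat) w)
    {w : ℂ} (hw : Z w ≠ 0) : |w.re| < 1 / 2 ∧ 1 ≤ |w.im| := by
  have hmem := mem_of_datum_ne_zero hZ hw
  have hre0 := ZetaZeros.riemannZetaNontrivialZeros.re_pos hmem
  have hre1 := ZetaZeros.riemannZetaNontrivialZeros.re_lt_one hmem
  have him : 14 < |((1 / 2 : ℂ) + w).im| := FordL33.fourteen_lt_abs_im ⟨1 / 2 + w, hmem⟩
  simp at hre0 hre1 him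
  refine ⟨abs_lt.2 ⟨by linarith, by linarith⟩, by linarith⟩

/-! ### (iii) the local count -/

/-- Part (iii) for `T ≥ 1`: the window sum is a finite sum over the zero box `0 < Im ρ ≤ T + 1`,
bounded by `window_count_le`. [folklore] -/
theorem datum_window_le_of_one_le (hZ : ∀ w : ℂ, Z w = Set.indicator ((fun v : ℂ => 1 / 2 + v) ⁻¹'
      ZetaZeros.riemannZetaNontrivialZeros) (fun v : ℂ => (riemannZetaZeroOrder (1 / 2 + v)).toNat) w)
    {T : ℝ} (hT : 1 ≤ T) :
    ∑' w : ℂ, (if |w.im - T| ≤ 1 then (Z w : ℝ) else 0) ≤ Real.log T + 20 := by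
  classical
  set box : Finset ℂ := (zetaZeroBox_finite 0 (T + 1)).toFinset with hbox
  set s : Finset ℂ := box.image (fun ρ : ℂ => ρ - 1 / 2) with hs
  have hvanish : ∀ w ∉ s, (if |w.im - T| ≤ 1 then (Z w : ℝ) else 0) = 0 := by
    intro w hw
    by_cases hwin : |w.im - T| ≤ 1
    · rw [if_pos hwin]
      by_cases hmem : (1 / 2 + w) ∈ ZetaZeros.riemannZetaNontrivialZeros
      · exfalso
        apply hw
        rw [hs, Finset.mem_image]
        refine ⟨1 / 2 + w, ?_, by ring⟩
        rw [hbox, Set.Finite.mem_toFinset]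
        have him : ((1 / 2 : ℂ) + w).im = w.im := by simp
        have hw1 := (abs_le.1 hwin).1
        have hw2 := (abs_le.1 hwin).2
        have hne := ZetaZeros.riemannZetaNontrivialZeros.im_ne_zero hmem
        refine ⟨ZetaZeros.riemannZetaNontrivialZeros.zeta_eq_zero hmem,
          (ZetaZeros.riemannZetaNontrivialZeros.re_pos hmem).le,
          (ZetaZeros.riemannZetaNontrivialZeros.re_lt_one hmem).le, ?_, ?_⟩
        · rw [him] at hne ⊢
          rcases lt_or_gt_of_ne hne with h | h
          · linarith
          · exact h
        · rw [him]; linarith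
      · rw [datum_eq_zero hZ hmem]; simp
    · rw [if_neg hwin]
  rw [tsum_eq_sum hvanish, hs, Finset.sum_image (fun x _ y _ h => sub_left_injective h)]
  calc ∑ ρ ∈ box, (if |(ρ - 1 / 2).im - T| ≤ 1 then (Z (ρ - 1 / 2) : ℝ) else 0)
      = ∑ ρ ∈ box, (if |ρ.im - T| ≤ 1 then (riemannZetaZeroOrder ρ : ℝ) else 0) := by
        refine Finset.sum_congr rfl fun ρ hρ => ?_
        have hρS : ρ ∈ ZetaZeros.riemannZetaNontrivialZeros :=
          zetaZeroBox_subset_riemannZetaNontrivialZeros 0 (T + 1) ((Set.Finite.mem_toFinset _).1 hρ)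
        have him : (ρ - 1 / 2 : ℂ).im = ρ.im := by simp
        rw [him, datum_shift_eq hZ hρS]
    _ ≤ Real.log T + 20 := window_count_le hT

/-- Part (iii): for `|T| ≥ 1`, `Σ_w 1_{|Im w − T| ≤ 1} Z(w) ≤ log|T| + 20` (the case `T ≤ −1` by
conjugation). [folklore] -/
theorem datum_window_le (hZ : ∀ w : ℂ, Z w = Set.indicator ((fun v : ℂ => 1 / 2 + v) ⁻¹'
      ZetaZeros.riemannZetaNontrivialZeros) (fun v : ℂ => (riemannZetaZeroOrder (1 / 2 + v)).toNat) w)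
    {T : ℝ} (hT : 1 ≤ |T|) :
    ∑' w : ℂ, (if |w.im - T| ≤ 1 then (Z w : ℝ) else 0) ≤ Real.log |T| + 20 := by
  rcases le_or_gt 0 T with h0 | h0
  · rw [abs_of_nonneg h0] at hT ⊢
    exact datum_window_le_of_one_le hZ hT
  · rw [abs_of_neg h0] at hT ⊢
    have hinv : Function.Involutive (starRingEnd ℂ) := Complex.conj_conj
    have key : ∑' w : ℂ, (if |w.im - T| ≤ 1 then (Z w : ℝ) else 0)
        = ∑' w : ℂ, (if |w.im - (-T)| ≤ 1 then (Z w : ℝ) else 0) := by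
      rw [← Equiv.tsum_eq (hinv.toPerm _) (fun w : ℂ => if |w.im - (-T)| ≤ 1 then (Z w : ℝ) else 0)]
      refine tsum_congr fun w => ?_
      simp only [Function.Involutive.coe_toPerm, Complex.conj_im, datum_conj hZ]
      have : |-w.im - -T| = |w.im - T| := by
        rw [show -w.im - -T = -(w.im - T) by ring, abs_neg]
      rw [this]
    rw [key]
    exact datum_window_le_of_one_le hZ hT

/-! ### (iv) Suzuki's series reindexed -/

/-- Part (iv): `Ψ(L) = Σ_w Z(w)·Re((cosh(wL) − 1)/w²)`. [folklore] -/
theorem zetaScrew_eq_datum_tsum (hZ : ∀ w : ℂ, Z w = Set.indicator ((fun v : ℂ => 1 / 2 + v) ⁻¹'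
      ZetaZeros.riemannZetaNontrivialZeros) (fun v : ℂ => (riemannZetaZeroOrder (1 / 2 + v)).toNat) w)
    (L : ℝ) :
    zetaScrew L = ∑' w : ℂ, (Z w : ℝ) * ((Complex.cosh (w * L) - 1) / w ^ 2).re := by
  have h := Complex.hasSum_re (Suzuki2023_thm11_series_holds L)
  simp only [Complex.ofReal_re] at h
  have h3 : HasSum (fun ρ : ZetaZeros.riemannZetaNontrivialZeros =>
      (riemannZetaZeroOrder (ρ : ℂ) : ℝ) *
        ((Complex.cosh (((ρ : ℂ) - 1 / 2) * L) - 1) / ((ρ : ℂ) - 1 / 2) ^ 2).re) (zetaScrew L) := by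
    convert h using 1
    funext ρ
    rw [← Complex.ofReal_intCast, Complex.re_ofReal_mul]
  have h4 : HasSum (fun w : ℂ => (Z w : ℝ) * ((Complex.cosh (w * L) - 1) / w ^ 2).re) (zetaScrew L) := by
    rw [hasSum_shift_iff (S := ZetaZeros.riemannZetaNontrivialZeros) _ (fun w hw => by
      rw [datum_eq_zero hZ hw]; simp)]
    convert h3 using 1
    funext ρ
    rw [datum_shift_eq hZ ρ.2]
  exact h4.tsum_eq.symm

/-! ### The item -/

/-- **Item `stmt-RiemannHypothesis-21806` (`IntegerScrew.ZetaScrewDatumAdmissible`), literally.**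
ζ's shifted zero datum `Z(w) = m(½ + w)` is admissible for the line's diagonal detection crux:
(i) `Σ Z(w)/|w|² = σ ≤ 1/20`, (ii) support in `|Re w| < ½`, `|Im w| ≥ 1`, (iii) local count
`≤ log|T| + 20` on every window `|Im w − T| ≤ 1`, `|T| ≥ 1`, (iv) `Ψ(L) = Σ_w Z(w)Re((cosh(wL)−1)/w²)`.
All four from PROVED tree inputs (`Suzuki2023_thm11_series_holds`, `tsum_zeroOrder_div_norm_sq_lt`,
`abs_zetaZeroCount_sub_main_le_explicit'`, `N(14) = 0`).  RH is not proved by this; nothing here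
bears on the truth of RH. -/
theorem zetaScrewDatumAdmissible : ∀ Z : ℂ → ℕ, (∀ w : ℂ, Z w = Set.indicator ((fun v : ℂ => 1 / 2 + v) ⁻¹' Literature.NumberTheory.LFunctions.ZetaZeros.riemannZetaNontrivialZeros) (fun v : ℂ => (Literature.NumberTheory.LFunctions.riemannZetaZeroOrder (1 / 2 + v)).toNat) w) → (∃ σ : ℝ, σ ≤ 1 / 20 ∧ HasSum (fun w : ℂ => (Z w : ℝ) / ‖w‖ ^ 2) σ) ∧ (∀ w : ℂ, Z w ≠ 0 → |w.re| < 1 / 2 ∧ 1 ≤ |w.im|) ∧ (∀ T : ℝ, 1 ≤ |T| → ∑' w : ℂ, (if |w.im - T| ≤ 1 then (Z w : ℝ) else 0) ≤ Real.log |T| + 20) ∧ (∀ L : ℝ, Literature.NumberTheory.LFunctions.zetaScrew L = ∑' w : ℂ, (Z w : ℝ) * ((Complex.cosh (w * L) - 1) / w ^ 2).re) := by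
  intro Z hZ
  exact ⟨datum_hasSum_div_norm_sq hZ, fun w hw => datum_support hZ hw,
    fun T hT => datum_window_le hZ hT, fun L => zetaScrew_eq_datum_tsum hZ L⟩

end Summit.RiemannHypothesis.RiemannHypothesis.Theorems.IntegerScrew

end
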